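import Mathlib.Topology.Metrizable.Basic
import Mathlib.Algebra.Group.End
import Mathlib.Data.Real.Basic
import HarnessLib

/-!
# Joshi, *Arithmetic Teichmüller Spaces III* (arXiv 2401.13508v4) §4.1–4.2: the variant adelic
Fargues–Fontaine curve `𝒴′_{L′}`, Mochizuki's Adelic Ansatz `Σ̃_{L′}`, and `Θgau`-Links à la Joshi

Block E typing file (cell abc-iut, rung LADDER-ABC:A2.E, seat abc-iut-E-t7, slot T-07; inventory
`HOME/plan/E/t7/INVENTORY.tsv`). TAKES NO SIDE on [IUTchIII] Cor. 3.12, on Joshi's claims, or on Mochizuki's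
reports on them. Typed ≠ proved; typed AS A CANDIDATE ≠ endorsed. The source is an unrefereed preprint
("Preliminary version for comments"); every statement Joshi ASSERTS is a `def … : Prop` carrying
`@[claim "Joshi2024ATS3" "disputed"]`, NEVER asserted; what FOLLOWS from the typed signature (and from the inputs
Joshi cites, typed as explicit hypotheses) is a proved `theorem … _of …` (here and in the companion file
`Joshi/AdelicAnsatzDerived.lean`: the `ϕ^ℤ` machinery, Thm. 4.2.2.1 (2)/(3) derived, Cor. 4.2.2.4 bookkeeping,
[J-2½] Lem. 4.1.2, Rmk. 4.2.3.4, a one-point model of the signature).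

SOURCES. [J-III] = K. Joshi, arXiv:2401.13508v4 = lit key `paper:arxiv-2401.13508`, render
`HOME/lit/renders/Joshi-arxiv-2401.13508/pNNNN.txt` («p.N l.M» = line M of PDF page N). [J-2½] = K. Joshi,
*Arithmetic Teichmüller Spaces II½*, arXiv:2305.10398 = [Joshi, 2023a] of [J-III] (render
`HOME/plan/repair/lit/renders/Joshi-arxiv-2305.10398-ATS2half`): Def. 4.1.1 / Rmk. 4.1.3 (adelic curves `𝒴_L`, `𝒴′_L`,
p.20 l.18 – p.21 l.45), (4.2.1) `G_L = ∏_v G_v` (p.21 l.51–55), Thm. 4.2.3 (the three actions, p.21 l.67 – p.22 l.66,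
proof p.23 l.14–92), Lem. 4.1.2 (metrisability, p.20 l.72–91). [J-2p] = K. Joshi, arXiv:2303.01662v3 = [Joshi, 2023b]
(bib `Joshi2023ATS2Local`), §6: Mochizuki's primitive ansatz `Σ̃_{C_p^♭} ⊂ Y^{ℓ*}_{C_p^♭,ℚ_p}` — block-E seat E-t3's
`Joshi/ThetaValuesLocus.lean`, MERGE-DEBT: the field `primAnsatz` below is that set and the three INPUT `Prop`s of §3 are
E-t3's Prop. 6.6.1 / 6.7.1 / Thm. 6.9.1 rows.

CONTENTS. §1 `AdelicCurveDatum` — the SIGNATURE of §4.1 / §4.2 prelim. / §4.2.1 over an abstract carrier (INTERIM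
CARRIER RULE, plan/E/ASSIGNMENTS.md §0.3; nothing asserted). §2 Def. 4.2.1 (three actions on `𝒴^{ℓ*}`; (3) with the
printed twist `x^{j²}`), components `z = (z_w)_w`, Def. 4.2.2 / (4.2.3) `adelicAnsatz`, (4.2.1.4) `localAnsatz`,
Def. 4.2.1.6. §3 Thm. 4.2.2.1 (1)–(5) as claim-`Prop`s, the [J-2p]/[J-2½] INPUTS of Joshi's proof as hypothesis
`Prop`s, and the derivations of (1), (4) (from the inputs) and (5) (unconditional). §4 Def. 4.2.3.1 `ThetaGauLink`
(«Mochizuki's Ansatz is the set of Θgau-Links»), Rmk. 4.2.3.2, Cor. 4.2.3.3 (metrisable, derived from Mathlib).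

READING QUESTION (flagged to E-ref / E-cx on STATUS; no verdict taken here). Thm. 4.2.2.1 (3), p.33 l.1–2: «Hence
Σ̃_{L′} is also stable under the natural action of (L′)* on 𝒴_{L′}». LITERAL reading = the `(L′)*`-action on `𝒴^{ℓ*}`
of Def. 4.2.1 (3), `x · z = (x·y₁, x^{2²}·y₂, …, x^{ℓ*²}·y_{ℓ*})` (`AnsatzLStarStable`); DIAGONAL reading = the action
induced factorwise from [J-2½] Thm. 4.2.3 (3) (`AnsatzLStarStableDiag`, derived in the companion file from [J-2½]
Thm. 4.2.3 (4)). The twist is not used downstream in [J-III] (§6.3 p.44 l.32, §6.4.1 p.45 l.43, §8.10 p.90 l.24,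
§9.4.8 p.105 l.68 cite membership in `Σ̃_{L′}` and the valuation scaling (4) only).

DICTIONARY HINTS FOR E3 (recorded, not typed; our side BY NAME only): Joshi's `Θgau`-Link (Def. 4.2.3.1: a POINT of
`Σ̃_{L′}`) ↔ print's Θ×μ_LGP-link (`Summit.ABC.IUTFork.Thm311.LinkData`, pilot law
`Summit.ABC.IUTFork.Cor312Vol.LinkPinned` = `Thm311ToCor312.PilotLink`); Joshi's valuation scaling (4.2.2.2)
`|−|_{K′_{w,j}} = |−|^{j²}_{K′_{w,1}}` ↔ the exponent law `j²` of the Θ-pilot (Rmk. 4.2.3.2 (2) cites [IUTchIII] for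
Mochizuki's version): Joshi scales VALUATIONS of residue fields of points of FF-curves, print scales the VALUES `q_v^{j²}`
of the pilot. No test file is written on this block before E-plan / E-cx rule the test shape.

NOT HERE: §4.3–4.6 (seat E-t8, which imports this carrier); the Initial Theta Data §3 (seat E-t6; only `ℓ*` and
`V^{odd,ss}` enter, as fields); the FF-curve itself, its adic/perfectoid structure, continuity / finite fibres of
(4.2.1.2) (used by no §4.2 statement); the variants `𝒴′^{max}`, `𝒴′^{R}` of Def. 4.2.3.1; normalised arithmeticoids.
-/

noncomputable section

open TopologicalSpace

namespace Summit.ABC.IUTFork.Joshi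

/-! ## 1. The signature: [J-III] §4.1, §4.2 (preliminaries), §4.2.1 -/

/-- **The carrier of [J-III] §4.1–4.2** (INTERIM CARRIER RULE: abstract signature, nothing asserted).
[J-III] §4.1, p.30 l.20–48: `L` a number field without real embeddings, an Initial Theta Data fixed (§2.4, §3.1,
§3.3), `L′ ⊃ L`; the variant adelic Fargues–Fontaine curve ([J-2½] Rmk. 4.1.3)
`𝒴′_{L′} = ∏_p ∏_{w∣p} |Y_{C_p^♭,L′_w}|` (4.1.1), «the product over p runs over all rational primes including
p = ∞»; §4.2, p.31 l.2–17: residue fields `K_{y_w}` and residue characteristics `p_w`, and the three actions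
`G_{L′} ↷ 𝒴_{L′}`, `L′* ↷ 𝒴_{L′}`, `ϕ ↷ 𝒴_{L′}` of [J-2½] Thm. 4.2.3 (with `G_{L′} = ∏_w G_w`, [J-2½] (4.2.1),
acting factorwise, proof p.23 l.14–22); §4.2.1, p.32 l.19–59: the forgetful map
`Y_{C_p^♭,E′_w} → Y_{C_p^♭,ℚ_p}` (4.2.1.2)–(4.2.1.3) [FF18 Prop. 2.3.20] and Mochizuki's primitive ansatz
`Σ̃_{C_p^♭} ⊂ Y^{ℓ*}_{C_p^♭,ℚ_p}` (4.2.1.5) of [J-2p] §6. MODELLING CHOICES (for the faithfulness referee):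
(a) all point-sets are abstract types; (b) the Frobenius at each factor is a bijection (`Equiv`), so that the
group `ϕ^ℤ` of Def. 4.2.1 (2) acts; (c) `L′*` is an abstract type with an abstract power map `lpow x n = xⁿ`
and the action law `lact (xⁿ) = (lact x)^[n]` — exactly what Def. 4.2.1 (3) uses; (d) «`|−|_{K_y}`» is an
`ℝ`-valued function on a common evaluation domain `T p` depending only on the residue characteristic (the elements —
Teichmüller lifts, `p` — on which (4.2.2.2) compares valuations of DIFFERENT residue fields; cf. [J-2p] Thm. 6.9.1
`v_{K_j}(p) = j² v_{K_1}(p)`); (e) the equivariance fields `forget_gal`, `forget_frob`, `forget_abs` record the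
functoriality of (4.2.1.2) ([FF18 Prop. 2.3.20 (3)]: isomorphism of local rings, used verbatim in the proof of
Thm. 4.2.2.1, p.33 l.67–75). [claim: Joshi2024ATS3, status: disputed] -/
structure AdelicCurveDatum : Type 1 where
  /-- `𝕍_{L′}`: all places of `L′` (archimedean ones included, p.30 l.45). -/
  V : Type
  /-- `V^{odd,ss}_{L′}` ([J-III] §3.2 (6), §3.4): odd places of bad semi-stable reduction. -/
  oddss : Set V
  /-- The rational primes including `∞` (p.30 l.45). -/
  P : Type
  /-- `w ↦ p_w`, the residue characteristic of `L′_w` (p.31 l.8–13; `p_w = ∞` for archimedean `w`). -/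
  pOf : V → P
  /-- `|Y_{C_p^♭,L′_w}|`: closed classical points of the local Fargues–Fontaine curve at `w` ([J-2½] Rmk. 4.1.3). -/
  Y : V → Type
  /-- `|Y_{C_p^♭,ℚ_p}|` (4.2.1.2), the target of the forgetful map ([J-2p] §2; E-t3's `PeriodRingDatum.Y`). -/
  Y0 : P → Type
  /-- The forgetful map (4.2.1.2)–(4.2.1.3) `(E′_w ↪ K, K^♭ ≃ C_p^♭) ↦ (K, K^♭ ≃ C_p^♭)`, p.32 l.19–45. -/
  forget : (w : V) → Y w → Y0 (pOf w)
  /-- `ℓ* = (ℓ − 1)/2` ([J-III] §3.3 (11)). -/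
  lstar : ℕ
  /-- `ℓ ≥ 5`, so `ℓ* ≥ 2 ≥ 1`; only `1 ≤ ℓ*` is needed to name the first and last index. -/
  one_le_lstar : 1 ≤ lstar
  /-- The local groups `G_w` with `G_{L′} = ∏_w G_w` ([J-2½] (4.2.1), p.21 l.51–55). -/
  G : V → Type
  /-- `G_w ↷ |Y_{C_p^♭,L′_w}|` ([J-2½] Thm. 4.2.3 (1), proof p.23 l.14–22: `G_L` acts through its factors). -/
  gact : (w : V) → G w → Y w → Y w
  /-- `G_{ℚ_p} ↷`-type group at the `ℚ_p`-level ([J-2p] Prop. 6.7.1's Galois action on `Y_{C_p^♭,ℚ_p}`). -/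
  G0 : P → Type
  /-- Its action on `|Y_{C_p^♭,ℚ_p}|`. -/
  g0act : (p : P) → G0 p → Y0 p → Y0 p
  /-- Restriction `G_w → G_{ℚ_{p_w}}` (`L′_w ⊃ ℚ_{p_w}`). -/
  res : (w : V) → G w → G0 (pOf w)
  /-- The forgetful map is Galois-equivariant ([FF18] functoriality of (4.2.1.2)). -/
  forget_gal : ∀ (w : V) (g : G w) (y : Y w), forget w (gact w g y) = g0act (pOf w) (res w g) (forget w y)
  /-- Frobenius `ϕ_w` of the factor at `w` ([J-2½] Thm. 4.2.3 (2)), a bijection of `|Y|`. -/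
  frob : (w : V) → Y w ≃ Y w
  /-- Frobenius of `|Y_{C_p^♭,ℚ_p}|` ([J-2p] §2). -/
  frob0 : (p : P) → Y0 p ≃ Y0 p
  /-- The forgetful map commutes with Frobenius ([FF18] functoriality of (4.2.1.2)). -/
  forget_frob : ∀ (w : V) (y : Y w), forget w (frob w y) = frob0 (pOf w) (forget w y)
  /-- `L′*` (abstract carrier of the multiplicative group of `L′`). -/
  Lstar : Type
  /-- `x ↦ xⁿ` on `L′*` (Def. 4.2.1 (3) uses `x^{j²}`). -/
  lpow : Lstar → ℕ → Lstar
  /-- `L′* ↷ |Y_{C_p^♭,L′_w}|` factorwise via the diagonal embedding `x ↦ (x)_w` ([J-2½] Thm. 4.2.3 (3), proof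
  p.23 l.26–32). -/
  lact : Lstar → (w : V) → Y w → Y w
  /-- Action law: `xⁿ` acts as the `n`-fold iterate of `x`. -/
  lact_lpow : ∀ (x : Lstar) (n : ℕ) (w : V) (y : Y w), lact (lpow x n) w y = (lact x w)^[n] y
  /-- Common evaluation domain at residue characteristic `p` for the residue valuations (modelling choice (d)). -/
  T : P → Type
  /-- `|−|_{K_{y_w}}`: the valuation of the residue field of `y_w ∈ |Y_{C_p^♭,L′_w}|` (p.31 l.3–8), on `T p_w`. -/
  absK : (w : V) → Y w → T (pOf w) → ℝ
  /-- `|−|_{K_y}` for `y ∈ |Y_{C_p^♭,ℚ_p}|` ([J-2p] §2, E-t3's `PeriodRingDatum.absK`). -/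
  absK0 : (p : P) → Y0 p → T p → ℝ
  /-- [FF18 Prop. 2.3.20 (3)] as used on p.33 l.67–75: the local rings (hence residue fields and their valuations)
  of `y′_{w,j}` and of its image under (4.2.1.2) are isomorphic. -/
  forget_abs : ∀ (w : V) (y : Y w), absK w y = absK0 (pOf w) (forget w y)
  /-- INPUT: Mochizuki's primitive ansatz `Σ̃_{C_p^♭} ⊂ Y^{ℓ*}_{C_p^♭,ℚ_p}` (4.2.1.5), [J-2p] Def. 6.2.3
  (merge-debt: E-t3's `primitiveAnsatz`). -/
  primAnsatz : (p : P) → Set (Fin lstar → Y0 p)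

namespace AdelicCurveDatum

variable (D : AdelicCurveDatum)

/-- `𝒴′_{L′} = ∏_w |Y_{C_p^♭,L′_w}|` (4.1.1), p.30 l.29–44, as the dependent product (product topology when the
factors are topologised, p.30 l.30 «topological space»). [claim: Joshi2024ATS3, status: disputed] -/
abbrev Curve : Type := (w : D.V) → D.Y w

/-- `(𝒴′_{L′})^{ℓ*} = 𝒴′ × ⋯ × 𝒴′` (`ℓ*` factors), (4.1.2), p.30 l.52–60; index `j = 1, …, ℓ*` is `Fin ℓ*`
via `printedIndex`. [claim: Joshi2024ATS3, status: disputed] -/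
abbrev Tuple : Type := Fin D.lstar → D.Curve

/-- The printed index `j ∈ {1, …, ℓ*}` of a `Fin ℓ*` position. -/
def printedIndex (j : Fin D.lstar) : ℕ := (j : ℕ) + 1

/-- The first index `j = 1`. -/
def jOne : Fin D.lstar := ⟨0, D.one_le_lstar⟩

/-- The last index `j = ℓ*`. -/
def jLast : Fin D.lstar := ⟨D.lstar - 1, Nat.sub_lt D.one_le_lstar Nat.one_pos⟩

/-- The first position prints as `j = 1`. -/
@[simp] theorem printedIndex_jOne : D.printedIndex D.jOne = 1 := rfl

/-- The last position prints as `j = ℓ*`. -/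
theorem printedIndex_jLast : D.printedIndex D.jLast = D.lstar := Nat.sub_add_cancel D.one_le_lstar

/-! ## 2. Def. 4.2.1, the components `z_w`, Def. 4.2.2 / (4.2.3), (4.2.1.4), Def. 4.2.1.6 -/

/-- `G_{L′} = ∏_w G_w ↷ 𝒴′_{L′}` factorwise ([J-2½] Thm. 4.2.3 (1)). -/
def galCurve (g : (w : D.V) → D.G w) (y : D.Curve) : D.Curve := fun w => D.gact w (g w) (y w)

/-- The global Frobenius `ϕ = (ϕ_w)_w ↷ 𝒴′_{L′}` ([J-2½] Thm. 4.2.3 (2)), a bijection. -/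
def frobCurve : Equiv.Perm D.Curve := Equiv.piCongrRight D.frob

/-- `L′* ↷ 𝒴′_{L′}` via the diagonal embedding ([J-2½] Thm. 4.2.3 (3)). -/
def lstarCurve (x : D.Lstar) (y : D.Curve) : D.Curve := fun w => D.lact x w (y w)

/-- **Def. 4.2.1 (1)**, p.31 l.20–23: the diagonal action `g · z = (g·y₁, …, g·y_{ℓ*})` of `G_{L′}` on `𝒴^{ℓ*}`.
[claim: Joshi2024ATS3, status: disputed] -/
def galTuple (g : (w : D.V) → D.G w) (z : D.Tuple) : D.Tuple := fun j => D.galCurve g (z j)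

/-- **Def. 4.2.1 (2)**, p.31 l.24–27: the diagonal Frobenius `ϕ(z) = (ϕ(y₁), …, ϕ(y_{ℓ*}))` on `𝒴^{ℓ*}`, as a
permutation, so that the group `ϕ^ℤ` acts by `(frobTuple D) ^ n`, `n : ℤ`. [claim: Joshi2024ATS3, status: disputed] -/
def frobTuple : Equiv.Perm D.Tuple := Equiv.piCongrRight fun _ => D.frobCurve

/-- **Def. 4.2.1 (3) AS PRINTED**, p.31 l.28–35: `x · z = (x·y₁, x^{2²}·y₂, …, x^{ℓ*²}·y_{ℓ*})`, «the action of
`L′*` on the `j`th factor of `𝒴^{ℓ*}` is by `x^{j²}` acting on this factor». [claim: Joshi2024ATS3, status: disputed] -/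
def lstarTupleTwisted (x : D.Lstar) (z : D.Tuple) : D.Tuple :=
  fun j => D.lstarCurve (D.lpow x (D.printedIndex j ^ 2)) (z j)

/-- The DIAGONAL `L′*`-action `x · z = (x·y₁, …, x·y_{ℓ*})` induced factorwise from [J-2½] Thm. 4.2.3 (3) — the
reading under which Thm. 4.2.2.1 (3) is derived in `AdelicAnsatzDerived` (module docstring: READING QUESTION). -/
def lstarTupleDiag (x : D.Lstar) (z : D.Tuple) : D.Tuple := fun j => D.lstarCurve x (z j)

/-- The `w`-component `z_w = (y_{1,w}, …, y_{ℓ*,w}) ∈ Y^{ℓ*}_{C_p^♭,L′_w}` of `z ∈ 𝒴^{ℓ*}`, p.31 l.36–47. -/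
def comp (z : D.Tuple) (w : D.V) : Fin D.lstar → D.Y w := fun j => z j w

/-- «each `z` may be thought of as a collection of `ℓ*`-tuples `z_w`», p.31 l.40–47: `z ↦ (z_w)_w` is a bijection. -/
def compEquiv : D.Tuple ≃ ((w : D.V) → Fin D.lstar → D.Y w) := Equiv.piComm _

/-- `compEquiv` is `comp`. -/
@[simp] theorem compEquiv_apply (z : D.Tuple) : D.compEquiv z = D.comp z := rfl

/-- **(4.2.1.4) / Def. 4.2.1.6 — Mochizuki's local Ansatz** `Σ̃_{C_p^♭,E′_w} ⊂ Y^{ℓ*}_{C_p^♭,E′_w}`, p.32 l.46–68: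
«the inverse image, under the above morphism (4.2.1.2), of Mochizuki's primitive ansatz `Σ̃_{C_p^♭}`» (the
morphism applied componentwise to `ℓ*`-tuples). Joshi defines it for `w ∈ V^{odd,ss}`; the definition makes sense
for every `w` and is only USED at `w ∈ V^{odd,ss}`. [claim: Joshi2024ATS3, status: disputed] -/
def localAnsatz (w : D.V) : Set (Fin D.lstar → D.Y w) :=
  {t | (fun j => D.forget w (t j)) ∈ D.primAnsatz (D.pOf w)}

/-- The diagonal condition of (4.2.3) at `w`: `z_w = (y_w, y_w, …, y_w)`. -/
def IsDiagonalAt (z : D.Tuple) (w : D.V) : Prop := ∀ j : Fin D.lstar, z j w = z D.jOne w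

/-- **Def. 4.2.2 / (4.2.3) — MOCHIZUKI'S ADELIC ANSATZ** `Σ̃_{L′} ⊂ (𝒴_{L′})^{ℓ*}`, p.31 l.48–81: `z ∈ Σ̃_{L′}` iff
`z_w = (y_w, y_w, …, y_w)` for `w ∈ 𝕍_{L′} − V^{odd,ss}` and `(y_{w,1}, …, y_{w,ℓ*}) ∈ Σ̃_{C_p^♭,L′_w}` for
`w ∈ V^{odd,ss}`. (Printed over `(𝒴_{L′})^{ℓ*}` in Def. 4.2.2 and over `(𝒴′_{L′})^{ℓ*}` in (4.1.2); typed over the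
one carrier `Curve`.) [claim: Joshi2024ATS3, status: disputed] -/
@[claim "Joshi2024ATS3" "disputed"]
def adelicAnsatz : Set D.Tuple :=
  {z | (∀ w, w ∉ D.oddss → D.IsDiagonalAt z w) ∧ (∀ w, w ∈ D.oddss → D.comp z w ∈ D.localAnsatz w)}

/-- Unfolding lemma for membership in `Σ̃_{L′}` (4.2.3). -/
theorem mem_adelicAnsatz_iff (z : D.Tuple) : z ∈ D.adelicAnsatz ↔
    (∀ w, w ∉ D.oddss → D.IsDiagonalAt z w) ∧ (∀ w, w ∈ D.oddss → D.comp z w ∈ D.localAnsatz w) := Iff.rfl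

/-- Unfolding lemma for membership in the local Ansatz (4.2.1.4). -/
theorem mem_localAnsatz_iff (w : D.V) (t : Fin D.lstar → D.Y w) :
    t ∈ D.localAnsatz w ↔ (fun j => D.forget w (t j)) ∈ D.primAnsatz (D.pOf w) := Iff.rfl

/-! ## 3. Thm. 4.2.2.1 (Cor. 4.2.2.4: companion file)

The INPUTS Joshi's proof cites (p.33 l.45–75) are results of [J-2p] (block-E seat E-t3) and [J-2½]; they are
typed here as hypothesis `Prop`s over the signature and enter the derived theorems as explicit hypotheses —
never asserted. -/

/-- INPUT [J-2p] Prop. 6.7.1 (cited p.33 l.45): `Σ̃_{C_p^♭}` is Galois stable. [claim: Joshi2023ATS2Local, status: disputed] -/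
@[claim "Joshi2023ATS2Local" "disputed"]
def PrimAnsatzGaloisStable : Prop :=
  ∀ (p : D.P) (g : D.G0 p) (t : Fin D.lstar → D.Y0 p), t ∈ D.primAnsatz p → (fun j => D.g0act p g (t j)) ∈ D.primAnsatz p

/-- INPUT [J-2p] Prop. 6.6.1 (cited p.33 l.46–47): `Σ̃_{C_p^♭}` is Frobenius stable — in `↔` form (the tuple of
`a` goes to the tuple of `ϕ(a) = a^p`, and `C_p^♭` is perfect), so that `ϕ^{−1}` is covered. [claim: Joshi2023ATS2Local, status: disputed] -/
@[claim "Joshi2023ATS2Local" "disputed"]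
def PrimAnsatzFrobeniusInvariant : Prop :=
  ∀ (p : D.P) (t : Fin D.lstar → D.Y0 p), t ∈ D.primAnsatz p ↔ (fun j => D.frob0 p (t j)) ∈ D.primAnsatz p

/-- INPUT [J-2p] Thm. 6.9.1 (cited p.33 l.65–67), VALUATION SCALING on the primitive ansatz: for
`(y₁, …, y_{ℓ*}) ∈ Σ̃_{C_p^♭}`, `|−|_{K_{y_j}} = |−|^{j²}_{K_{y_1}}` (E-t3's `valuationScaling`). [claim: Joshi2023ATS2Local, status: disputed] -/
@[claim "Joshi2023ATS2Local" "disputed"]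
def PrimAnsatzScaling : Prop :=
  ∀ (p : D.P) (t : Fin D.lstar → D.Y0 p), t ∈ D.primAnsatz p →
    ∀ (j : Fin D.lstar) (s : D.T p), D.absK0 p (t j) s = D.absK0 p (t D.jOne) s ^ (D.printedIndex j ^ 2)

/-- INPUT [J-2½] Thm. 4.2.3 (4), p.22 l.1–15 (proof p.23 l.43–72: `O*_{L_v}` acts trivially, a uniformizer acts by
Frobenius), stated where Thm. 4.2.2.1 (3) needs it: at each `w ∈ V^{odd,ss}` (non-archimedean) every `x ∈ L′*` acts
on `|Y_{C_p^♭,L′_w}|` through an integer power of `ϕ_w`. [claim: Joshi2024ATS3, status: disputed] -/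
@[claim "Joshi2024ATS3" "disputed"]
def LStarThroughFrobenius : Prop :=
  ∀ w, w ∈ D.oddss → ∀ x : D.Lstar, ∃ n : ℤ, ∀ y : D.Y w, D.lact x w y = (D.frob w ^ n) y

/-- **Thm. 4.2.2.1 (1)**, p.32 l.76–80: «The set `Σ̃_{L′}` is stable under the natural action of `G_{L′}` on
`(𝒴′_{L′})^{ℓ*}`» (Def. 4.2.1 (1)). Typed, not asserted. [claim: Joshi2024ATS3, status: disputed] -/
@[claim "Joshi2024ATS3" "disputed"]
def AnsatzGaloisStable : Prop :=
  ∀ (g : (w : D.V) → D.G w) (z : D.Tuple), z ∈ D.adelicAnsatz → D.galTuple g z ∈ D.adelicAnsatz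

/-- **Thm. 4.2.2.1 (2)**, p.32 l.81–84: «`Σ̃_{L′}` is stable under the natural action of the (global) Frobenius `ϕ`
on `(𝒴′_{L′})^{ℓ*}`» (Def. 4.2.1 (2)). Typed, not asserted. [claim: Joshi2024ATS3, status: disputed] -/
@[claim "Joshi2024ATS3" "disputed"]
def AnsatzFrobeniusStable : Prop := ∀ z : D.Tuple, z ∈ D.adelicAnsatz → D.frobTuple z ∈ D.adelicAnsatz

/-- **Thm. 4.2.2.1 (3), LITERAL READING**, p.33 l.1–2: «Hence `Σ̃_{L′}` is also stable under the natural action of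
`(L′)*` …» with the `(L′)*`-action on `𝒴^{ℓ*}` of Def. 4.2.1 (3) (twist `x^{j²}` on the `j`-th factor). Typed, not
asserted, NOT derived here (READING QUESTION, module docstring). [claim: Joshi2024ATS3, status: disputed] -/
@[claim "Joshi2024ATS3" "disputed"]
def AnsatzLStarStable : Prop :=
  ∀ (x : D.Lstar) (z : D.Tuple), z ∈ D.adelicAnsatz → D.lstarTupleTwisted x z ∈ D.adelicAnsatz

/-- **Thm. 4.2.2.1 (3), DIAGONAL READING**: stability under the diagonal `(L′)*`-action induced from [J-2½]
Thm. 4.2.3 (3) («the natural action of `(L′)*` on `𝒴_{L′}`»). Derived in `AdelicAnsatzDerived`. [claim: Joshi2024ATS3, status: disputed] -/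
@[claim "Joshi2024ATS3" "disputed"]
def AnsatzLStarStableDiag : Prop :=
  ∀ (x : D.Lstar) (z : D.Tuple), z ∈ D.adelicAnsatz → D.lstarTupleDiag x z ∈ D.adelicAnsatz

/-- **Thm. 4.2.2.1 (4) / (4.2.2.2) — VALUATION SCALING**, p.33 l.3–36: for `(y′₁, …, y′_{ℓ*}) ∈ Σ̃_{L′}`, each
`w ∈ V^{odd,ss}`, `w`-component `(y′_{w,1}, …, y′_{w,ℓ*})` with residue fields `K′_{w,j}`:
`|−|_{K′_{w,j}} = |−|^{j²}_{K′_{w,1}}` for `j = 1, …, ℓ*`. «The scaling relationship … has fundamental consequences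
for global arithmetic» (p.33 l.78–79); Rmk. 4.2.3.2 (2): «central to [IUTchIII] Cor. 3.12». Typed, not asserted.
[claim: Joshi2024ATS3, status: disputed] -/
@[claim "Joshi2024ATS3" "disputed"]
def ValuationScaling : Prop :=
  ∀ z : D.Tuple, z ∈ D.adelicAnsatz → ∀ w, w ∈ D.oddss → ∀ (j : Fin D.lstar) (t : D.T (D.pOf w)),
    D.absK w (z j w) t = D.absK w (z D.jOne w) t ^ (D.printedIndex j ^ 2)

/-- **Thm. 4.2.2.1 (5) / (4.2.2.3)**, p.33 l.37–44: for `w ∈ 𝕍_{L′} − V^{odd,ss}`, `|−|_{K′_{w,j}} = |−|_{K′_{w,1}}`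
for `j = 1, …, ℓ*` («immediate from the definition of `Σ̃_{L′}`», p.33 l.76). Derived unconditionally below.
[claim: Joshi2024ATS3, status: disputed] -/
@[claim "Joshi2024ATS3" "disputed"]
def ValuationConstantOffSS : Prop :=
  ∀ z : D.Tuple, z ∈ D.adelicAnsatz → ∀ w, w ∉ D.oddss → ∀ (j : Fin D.lstar) (t : D.T (D.pOf w)),
    D.absK w (z j w) t = D.absK w (z D.jOne w) t

/-- The forgetful map intertwines the diagonal Galois action on `w`-components (from `forget_gal`). -/
theorem forget_comp_galTuple (g : (w : D.V) → D.G w) (z : D.Tuple) (w : D.V) :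
    (fun j => D.forget w (D.comp (D.galTuple g z) w j)) =
      fun j => D.g0act (D.pOf w) (D.res w (g w)) (D.forget w (D.comp z w j)) := by
  funext j; exact D.forget_gal w (g w) (z j w)

/-- **Thm. 4.2.2.1 (1) DERIVED** from the input [J-2p] Prop. 6.7.1 — Joshi's proof, p.33 l.45: at `w ∈ V^{odd,ss}`
the image of `g · z_w` under (4.2.1.2) is `res(g_w) ·` (image of `z_w`), which stays in `Σ̃_{C_p^♭}`; elsewhere the
diagonal condition is preserved. [claim: Joshi2024ATS3, status: disputed] -/
theorem ansatzGaloisStable_of (h : D.PrimAnsatzGaloisStable) : D.AnsatzGaloisStable := by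
  intro g z hz
  refine ⟨fun w hw j => ?_, fun w hw => ?_⟩
  · show D.gact w (g w) (z j w) = D.gact w (g w) (z D.jOne w)
    rw [hz.1 w hw j]
  · show (fun j => D.forget w (D.comp (D.galTuple g z) w j)) ∈ D.primAnsatz (D.pOf w)
    rw [D.forget_comp_galTuple]
    exact h (D.pOf w) (D.res w (g w)) _ (hz.2 w hw)

/-- **Thm. 4.2.2.1 (4) DERIVED** from the input [J-2p] Thm. 6.9.1 — exactly the printed proof, p.33 l.48–75: the
image `(y_{p,1}, …, y_{p,ℓ*})` of the `w`-component under (4.2.1.2) lies in `Σ̃_{C_p^♭}`, where (4.2.2.2) holds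
([J-2p] Thm. 6.9.1), and the residue valuations of `y_{p,j}` and `y′_{w,j}` agree ([FF18 Prop. 2.3.20 (3)],
field `forget_abs`). [claim: Joshi2024ATS3, status: disputed] -/
theorem valuationScaling_of (h : D.PrimAnsatzScaling) : D.ValuationScaling := by
  intro z hz w hw j t
  rw [D.forget_abs w (z j w), D.forget_abs w (z D.jOne w)]
  exact h (D.pOf w) (fun j => D.forget w (z j w)) (hz.2 w hw) j t

/-- **Thm. 4.2.2.1 (5) DERIVED, unconditionally**: off `V^{odd,ss}` the component is diagonal, so
`K′_{w,j} = K′_{w,1}` (p.33 l.76 «immediate from the definition»). [claim: Joshi2024ATS3, status: disputed] -/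
theorem valuationConstantOffSS_holds : D.ValuationConstantOffSS := by
  intro z hz w hw j t
  rw [hz.1 w hw j]

/-! ## 4. §4.2.3 «Mochizuki's Ansatz is the set of Θgau-Links»: Def. 4.2.3.1, Rmk. 4.2.3.2, Cor. 4.2.3.3 (Rmk. 4.2.3.4: companion) -/

/-- **Def. 4.2.3.1 — `Θgau`-LINK (à la Joshi)**, p.34 l.13–38: «Let `(y′₁, …, y′_{ℓ*}) ∈ Σ̃_{L′}`. Then the
assignment `y′₁ ↦ (y′₁, y′₂, …, y′_{ℓ*}) ∈ Σ̃_{L′}` will be called a `Θgau`-Link. Sometimes I will write this as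
`Σ̃_{L′} ∋ (y′₁, …, y′_{ℓ*}) ↦ y′_{ℓ*} ∈ 𝒴′_{L′}`. Thus `Σ̃_{L′}` is the set of `Θgau`-links (more precisely
`Θgau`-Links in `𝒴′_{L′}` …).» A link is determined by its tuple; `source`/`target` are the two printed
projections. DICTIONARY (E3, by name only): print's Θ×μ_LGP-link is `Summit.ABC.IUTFork.Thm311.LinkData` with
pilot law `Summit.ABC.IUTFork.Cor312Vol.LinkPinned`. [claim: Joshi2024ATS3, status: disputed] -/
structure ThetaGauLink : Type where
  /-- The point `(y′₁, …, y′_{ℓ*})` of `𝒴^{ℓ*}`. -/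
  tuple : D.Tuple
  /-- … lying in Mochizuki's Adelic Ansatz `Σ̃_{L′}`. -/
  mem : tuple ∈ D.adelicAnsatz

/-- The source `y′₁ ∈ 𝒴′_{L′}` of a `Θgau`-Link (p.34 l.17–21). -/
def ThetaGauLink.source (Λ : D.ThetaGauLink) : D.Curve := Λ.tuple D.jOne

/-- The target `y′_{ℓ*} ∈ 𝒴′_{L′}` of a `Θgau`-Link (the second writing, p.34 l.23–28). -/
def ThetaGauLink.target (Λ : D.ThetaGauLink) : D.Curve := Λ.tuple D.jLast

/-- **Rmk. 4.2.3.2 (1)**, p.34 l.40: «Thus a `Θgau`-Link is simply a point of Mochizuki's Adelic Ansatz `Σ̃_{L′}`»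
— as a bijection. (Rmk. 4.2.3.2 (2), p.34 l.41–45, is the comparison sentence recorded in the module docstring:
«Mochizuki's version of `Θgau`-Link is introduced in [Mochizuki, 2021c] and Mochizuki asserts in [Mochizuki, 2021c,
Proposition 4.1(iv), Page 344] that it has the valuation scaling property established here as Theorem 4.2.2.1(3).
This property is central to [Mochizuki, 2021c, Corollary 3.12] and [Mochizuki, 2021d]»; (3) refers to Prop. 4.3.1,
seat E-t8.) [claim: Joshi2024ATS3, status: disputed] -/
def thetaGauLinkEquiv : D.ThetaGauLink ≃ D.adelicAnsatz where
  toFun Λ := ⟨Λ.tuple, Λ.mem⟩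
  invFun z := ⟨z.1, z.2⟩
  left_inv _ := rfl
  right_inv _ := rfl

/-- **Cor. 4.2.3.3**, p.34 l.50–52: «Mochizuki's Adelic Ansatz `Σ̃_{L′}` is a metrisable space with the topology and
the metric induced from `𝒴^{ℓ*}_{L′}`» — as a `Prop` over a topologised signature (product and subspace
topologies are Mathlib's). Typed; derived below from [J-2½] Thm. 5.1.5 / Lem. 4.1.2 taken as the instance
hypothesis «`𝒴′_{L′}` is metrisable». [claim: Joshi2024ATS3, status: disputed] -/
@[claim "Joshi2024ATS3" "disputed"]
def AnsatzMetrisable [∀ w, TopologicalSpace (D.Y w)] : Prop := MetrizableSpace D.adelicAnsatz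

/-- **Cor. 4.2.3.3 DERIVED** (Joshi's proof, p.34 l.53–54: «immediate from [Joshi, 2023a, Theorem 5.1.5] as
`𝒴_{L′}` is a metrisable topological space»): a subspace of a finite power of a metrisable space is metrisable
(Mathlib's `metrizableSpace_pi` and `MetrizableSpace.subtype`). [claim: Joshi2024ATS3, status: disputed] -/
theorem ansatzMetrisable_of [∀ w, TopologicalSpace (D.Y w)] [MetrizableSpace D.Curve] : D.AnsatzMetrisable := by
  unfold AnsatzMetrisable; infer_instance

end AdelicCurveDatum

end Summit.ABC.IUTFork.Joshi

end
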